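import Mathlib
import Literature.MathematicalPhysics.StatisticalMechanics.BarlowStacking
import Literature.MathematicalPhysics.StatisticalMechanics.HaggStacking
import Literature.MathematicalPhysics.StatisticalMechanics.Crystallization

/-!
# Flexible-gap layered patterns: coordinates, the index box, the parameter space (lens-3 g12, residual `R`, part 1)

decomp-a2c · lens-3 · generation 12 · crux `ChartedPlanarOrder.ChartedZeroExcessLayered` (stmt-AtomisticToContinuum-26636),
registered skeleton `ChartedZeroExcessLayered_window_birth.lean` (sha256 660351068daaba86), stub `stub_walkTransportEnvS`.
This file is the geometric half of the measurability residual `R` «DefectEventNullMeasurable» (part 2: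
`ChartedPlanarOrderDefectEventMeasurable.lean`): the pattern vector `patVec b h zm i j = i•t₁(b) + j•t₂(b) + h•off(b) + zm•e₃`
of the strict defect event, its coordinates, the bound `39 b/50 · |m| ≤ |z m|` (with `|haggLabel s m| ≤ |m|` inlined), and the
INDEX BOX: a pattern point of norm `≤ 5` has `(|m|, |i|, |j|) ≤ (7, 13, 8)` for EVERY admissible parameter; then the
parameter space `Param = ℝ × (E →L E) × (ℤ → ℤ) × (ℤ → ℝ)`, the admissible set `piSet`, the pattern points `pt`
and their frozen-label version `ptL` (continuous in the parameter); finally the three auxiliary DEFINITIONS used by parts 2–6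
(`Bset`, `ljBound`, `rootEnergy'`), collected here so that the later parts are definition-free.  No new Prop definitions; axioms standard.
-/

set_option maxHeartbeats 800000

namespace Summit.AtomisticToContinuum.Crystallization.Theorems.ChartedPlanarOrderDefectEventGeometry

open MeasureTheory Metric Literature.MathematicalPhysics.StatisticalMechanics

/-- the flexible-gap layered pattern vector: in-plane indices `(i, j)`, letter label `h`, height `zm`, scale `b` -/
noncomputable def patVec (b : ℝ) (h : ℤ) (zm : ℝ) (i j : ℤ) : EuclideanSpace ℝ (Fin 3) :=
  ((i : ℝ) • triangularVec₁ b) + ((j : ℝ) • triangularVec₂ b) + ((h : ℝ) • barlowOffset b) + (zm • layerNormal 1)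

/-- first coordinate of the pattern vector: `b (i + j/2 + h/2)`. -/
@[simp] theorem patVec_apply_zero (b : ℝ) (h : ℤ) (zm : ℝ) (i j : ℤ) :
    patVec b h zm i j 0 = b * (i + j / 2 + h / 2) := by
  simp [patVec, triangularVec₁, triangularVec₂, barlowOffset, layerNormal]; ring

/-- second coordinate of the pattern vector: `b √3/2 (j + h/3)`. -/
@[simp] theorem patVec_apply_one (b : ℝ) (h : ℤ) (zm : ℝ) (i j : ℤ) :
    patVec b h zm i j 1 = b * √3 / 2 * (j + h / 3) := by
  simp [patVec, triangularVec₁, triangularVec₂, barlowOffset, layerNormal]; ring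

/-- third coordinate of the pattern vector: the height `zm`. -/
@[simp] theorem patVec_apply_two (b : ℝ) (h : ℤ) (zm : ℝ) (i j : ℤ) :
    patVec b h zm i j 2 = zm := by
  simp [patVec, triangularVec₁, triangularVec₂, barlowOffset, layerNormal]

/-- `patVec` is affine in `(b, zm)`: `patVec b h zm i j = b • patVec 1 h 0 i j + zm • layerNormal 1`. -/
theorem patVec_eq_smul (b : ℝ) (h : ℤ) (zm : ℝ) (i j : ℤ) :
    patVec b h zm i j = b • patVec 1 h 0 i j + zm • layerNormal 1 := by
  ext k
  fin_cases k <;> simp [patVec, triangularVec₁, triangularVec₂, barlowOffset, layerNormal] <;> ring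

/-- heights of a flexible-gap stacking with `z 0 = 0` and gaps `≥ 39 b / 50`: `39 b / 50 · |m| ≤ |z m|` -/
theorem height_bound {b : ℝ} {z : ℤ → ℝ} (hgap : ∀ m : ℤ, 39 / 50 * b ≤ z (m + 1) - z m) (hz0 : z 0 = 0)
    (m : ℤ) : 39 / 50 * b * |(m : ℝ)| ≤ |z m| := by
  -- nonnegative indices
  have hpos : ∀ n : ℕ, 39 / 50 * b * n ≤ z n := by
    intro n
    induction n with
    | zero => simp [hz0]
    | succ n ih =>
      have := hgap n
      push_cast at this ⊢
      linarith
  have hnegx : ∀ n : ℕ, 39 / 50 * b * n ≤ - z (-(n : ℤ)) := by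
    intro n
    induction n with
    | zero => simp [hz0]
    | succ n ih =>
      have := hgap (-(n + 1 : ℕ))
      have h1 : (-(n + 1 : ℕ) : ℤ) + 1 = -(n : ℤ) := by push_cast; ring
      rw [h1] at this
      push_cast at this ih ⊢
      linarith
  rcases le_or_gt 0 m with hm | hm
  · obtain ⟨n, rfl⟩ := Int.eq_ofNat_of_zero_le hm
    have h := hpos n
    rw [Int.cast_natCast, Nat.abs_cast]
    exact h.trans (le_abs_self _)
  · obtain ⟨n, hn⟩ := Int.exists_eq_neg_ofNat (le_of_lt hm)
    subst hn
    have h := hnegx n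
    rw [Int.cast_neg, Int.cast_natCast, abs_neg, Nat.abs_cast]
    exact h.trans (neg_le_abs _)

/-- THE INDEX BOX: a pattern point of norm `≤ 5` (scale `b ≥ 9/10`, Hägg labels, gaps `≥ 39 b/50`, `z 0 = 0`)
has layer index `|m| ≤ 7` and in-plane indices `|j| ≤ 8`, `|i| ≤ 13`. -/
theorem index_box {b : ℝ} (hb : 9 / 10 ≤ b) {s : ℤ → ℤ} (hs : IsHaggSeq s) {z : ℤ → ℝ}
    (hgap : ∀ m : ℤ, 39 / 50 * b ≤ z (m + 1) - z m) (hz0 : z 0 = 0)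
    (A : EuclideanSpace ℝ (Fin 3) →L[ℝ] EuclideanSpace ℝ (Fin 3)) (hA : ∀ v, ‖A v‖ = ‖v‖)
    {m i j : ℤ} (hn : ‖A (patVec b (haggLabel s m) (z m) i j)‖ ≤ 5) :
    |m| ≤ 7 ∧ |j| ≤ 8 ∧ |i| ≤ 13 := by
  rw [hA] at hn
  set v := patVec b (haggLabel s m) (z m) i j with hv
  have h2 : |z m| ≤ 5 := by
    have : |v 2| ≤ ‖v‖ := by simpa using PiLp.norm_apply_le v 2
    rw [hv, patVec_apply_two] at this
    exact this.trans (hv ▸ hn)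
  have hzm := height_bound hgap hz0 m
  have hm7r : |(m : ℝ)| ≤ 5 / (39 / 50 * b) := by
    rw [le_div_iff₀ (by positivity)]
    nlinarith
  have hm7 : |m| ≤ 7 := by
    have h57 : (5 : ℝ) / (39 / 50 * b) < 8 := by
      rw [div_lt_iff₀ (by positivity)]; nlinarith
    have h8r : |(m : ℝ)| < 8 := lt_of_le_of_lt hm7r h57
    have h8 : |m| < 8 := by exact_mod_cast h8r
    have := abs_lt.mp h8
    rw [abs_le]; constructor <;> omega
  -- `|haggWindow s m k| ≤ k` and `|haggLabel s m| ≤ |m|` for a `±1` word (folklore; also in the tree as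
  -- `GscHingeGlue.abs_haggWindow_le` / `abs_haggLabel_le`, inlined here to keep this file's imports built on the farm)
  have hwin : ∀ (m₀ : ℤ) (k : ℕ), |haggWindow s m₀ k| ≤ k := by
    intro m₀ k
    unfold haggWindow
    refine (Finset.abs_sum_le_sum_abs _ _).trans ?_
    have : ∀ i ∈ Finset.range k, |s (m₀ + i)| ≤ 1 := by
      intro i _
      rcases hs (m₀ + i) with h | h <;> simp [h]
    calc ∑ i ∈ Finset.range k, |s (m₀ + ↑i)| ≤ ∑ _i ∈ Finset.range k, (1 : ℤ) := Finset.sum_le_sum this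
      _ = k := by simp
  have hlabel : |haggLabel s m| ≤ |m| := by
    unfold haggLabel
    split_ifs with hm
    · have := hwin 0 m.toNat
      rw [show ((m.toNat : ℕ) : ℤ) = m from Int.toNat_of_nonneg hm] at this
      exact this.trans (le_abs_self m)
    · rw [abs_neg]
      have := hwin m (-m).toNat
      have hneg : 0 ≤ -m := by omega
      rw [show (((-m).toNat : ℕ) : ℤ) = -m from Int.toNat_of_nonneg hneg] at this
      exact this.trans (neg_le_abs m)
  have hlab : |haggLabel s m| ≤ 7 := hlabel.trans hm7
  have hlabr : |(haggLabel s m : ℝ)| ≤ 7 := by rw [← Int.cast_abs]; exact_mod_cast hlab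
  -- coordinate 1
  have h1 : |b * √3 / 2 * (j + haggLabel s m / 3)| ≤ 5 := by
    have : |v 1| ≤ ‖v‖ := by simpa using PiLp.norm_apply_le v 1
    rw [hv, patVec_apply_one] at this
    exact this.trans (hv ▸ hn)
  have h3 : (√3 : ℝ) ^ 2 = 3 := Real.sq_sqrt (by norm_num)
  have hsq1 : (b * √3 / 2 * (j + haggLabel s m / 3)) ^ 2 ≤ 25 := by
    have := abs_le.mp h1
    nlinarith
  have hj8 : |j| ≤ 8 := by
    -- (3 j + h)^2 ≤ 300 / b^2 ≤ 371 ⇒ |3 j + h| ≤ 19 ⇒ |j| ≤ 8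
    have hkey : b ^ 2 * (3 * (j : ℝ) + haggLabel s m) ^ 2 ≤ 300 := by nlinarith
    have hb2 : (81 : ℝ) / 100 ≤ b ^ 2 := by nlinarith
    have hkey2 : (3 * (j : ℝ) + haggLabel s m) ^ 2 ≤ 371 := by nlinarith
    have hlt : |3 * (j : ℝ) + haggLabel s m| < 20 := by
      have := abs_le_of_sq_le_sq' (by nlinarith : (3 * (j : ℝ) + haggLabel s m) ^ 2 ≤ 20 ^ 2) (by norm_num)
      rcases this with ⟨hl, hu⟩
      have hne : (3 * (j : ℝ) + haggLabel s m) ^ 2 ≠ 20 ^ 2 := by nlinarith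
      rw [abs_lt]; constructor
      · rcases hl.lt_or_eq with hl' | hl'
        · linarith
        · exfalso; apply hne; rw [← hl']; norm_num
      · rcases hu.lt_or_eq with hu' | hu'
        · exact hu'
        · exfalso; apply hne; rw [hu']
    have hjr : |(j : ℝ)| < 9 := by
      have := abs_le.mp hlabr
      rw [abs_lt] at hlt ⊢
      constructor <;> linarith [this.1, this.2, hlt.1, hlt.2]
    have h9 : |j| < 9 := by exact_mod_cast hjr
    have := abs_lt.mp h9
    rw [abs_le]; constructor <;> omega
  -- coordinate 0
  have h0 : |b * (i + j / 2 + haggLabel s m / 2)| ≤ 5 := by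
    have : |v 0| ≤ ‖v‖ := by simpa using PiLp.norm_apply_le v 0
    rw [hv, patVec_apply_zero] at this
    exact this.trans (hv ▸ hn)
  have hjr8 : |(j : ℝ)| ≤ 8 := by rw [← Int.cast_abs]; exact_mod_cast hj8
  have hi13 : |i| ≤ 13 := by
    have hb0 : 0 < b := by linarith
    have hin : |(i : ℝ) + j / 2 + haggLabel s m / 2| ≤ 5 / b := by
      rw [abs_mul, abs_of_pos hb0] at h0
      rw [le_div_iff₀ hb0]; linarith
    have h5b : (5 : ℝ) / b ≤ 50 / 9 := by
      rw [div_le_iff₀ hb0]; linarith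
    have hir : |(i : ℝ)| < 14 := by
      have hj := abs_le.mp hjr8
      have hl := abs_le.mp hlabr
      have hh := abs_le.mp (hin.trans h5b)
      rw [abs_lt]; constructor <;> linarith [hj.1, hj.2, hl.1, hl.2, hh.1, hh.2]
    have h14 : |i| < 14 := by exact_mod_cast hir
    have := abs_lt.mp h14
    rw [abs_le]; constructor <;> omega
  exact ⟨hm7, hj8, hi13⟩



/-! ## Parameter space, pattern points, continuity -/

/-- parameter space: scale `b`, frame `A` (a continuous linear map, constrained below to preserve norms),
Hägg word `s`, heights `z` -/
abbrev Param := ℝ × ((EuclideanSpace ℝ (Fin 3) →L[ℝ] EuclideanSpace ℝ (Fin 3)) × ((ℤ → ℤ) × (ℤ → ℝ)))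

/-- the admissible parameters of the strict defect event -/
def piSet : Set Param :=
  {π | 9 / 10 ≤ π.1 ∧ π.1 ≤ 1 ∧ (∀ v, ‖π.2.1 v‖ = ‖v‖) ∧ IsHaggSeq π.2.2.1 ∧
    (∀ m : ℤ, 39 / 50 * π.1 ≤ π.2.2.2 (m + 1) - π.2.2.2 m ∧ π.2.2.2 (m + 1) - π.2.2.2 m ≤ 17 / 20 * π.1) ∧
    π.2.2.2 0 = 0}

/-- the pattern point with index `k = (m, i, j)` of the parameter `π` -/
noncomputable def pt (π : Param) (k : ℤ × ℤ × ℤ) : EuclideanSpace ℝ (Fin 3) :=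
  π.2.1 (patVec π.1 (haggLabel π.2.2.1 k.1) (π.2.2.2 k.1) k.2.1 k.2.2)

/-- the same point with the letter labels frozen at a reference word `s₀` (this one is continuous in `π`) -/
noncomputable def ptL (s₀ : ℤ → ℤ) (k : ℤ × ℤ × ℤ) (π : Param) : EuclideanSpace ℝ (Fin 3) :=
  π.2.1 (patVec π.1 (haggLabel s₀ k.1) (π.2.2.2 k.1) k.2.1 k.2.2)

/-- with the letter labels frozen, a pattern point depends continuously on `(b, A, z)`. -/
theorem continuous_ptL (s₀ : ℤ → ℤ) (k : ℤ × ℤ × ℤ) : Continuous (ptL s₀ k) := by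
  have h : ptL s₀ k = fun π : Param =>
      π.2.1 (π.1 • patVec 1 (haggLabel s₀ k.1) 0 k.2.1 k.2.2 + π.2.2.2 k.1 • layerNormal 1) := by
    funext π; unfold ptL; rw [patVec_eq_smul]
  rw [h]
  have hA : Continuous fun π : Param => π.2.1 := continuous_fst.comp continuous_snd
  have hz : Continuous fun π : Param => π.2.2.2 k.1 :=
    (continuous_apply k.1).comp (continuous_snd.comp (continuous_snd.comp continuous_snd))
  have hv : Continuous fun π : Param =>
      π.1 • patVec 1 (haggLabel s₀ k.1) 0 k.2.1 k.2.2 + π.2.2.2 k.1 • layerNormal 1 :=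
    (continuous_fst.smul continuous_const).add (hz.smul continuous_const)
  exact (isBoundedBilinearMap_apply (𝕜 := ℝ) (E := EuclideanSpace ℝ (Fin 3))
    (F := EuclideanSpace ℝ (Fin 3))).continuous.comp (hA.prodMk hv)

/-- window sums agree for words agreeing on the window. -/
theorem haggWindow_congr {s s₀ : ℤ → ℤ} {M : ℕ} (h : ∀ i : ℤ, |i| ≤ M → s i = s₀ i) (m : ℤ) (k : ℕ)
    (hmk : ∀ i : ℕ, i < k → |m + i| ≤ M) : haggWindow s m k = haggWindow s₀ m k := by
  unfold haggWindow
  exact Finset.sum_congr rfl (fun i hi => h _ (hmk i (Finset.mem_range.mp hi)))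

/-- letter labels `haggLabel · m`, `|m| ≤ M`, agree for words agreeing on `[-M, M]`. -/
theorem haggLabel_congr {s s₀ : ℤ → ℤ} {M : ℕ} (h : ∀ i : ℤ, |i| ≤ M → s i = s₀ i) {m : ℤ} (hm : |m| ≤ M) :
    haggLabel s m = haggLabel s₀ m := by
  have hm' := abs_le.mp hm
  unfold haggLabel
  split_ifs with h0
  · apply haggWindow_congr h
    intro i hi
    have h1 : ((m.toNat : ℕ) : ℤ) = m := Int.toNat_of_nonneg h0
    have h2 : (i : ℤ) < m := by rw [← h1]; exact_mod_cast hi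
    rw [abs_le]; constructor <;> omega
  · congr 1
    apply haggWindow_congr h
    intro i hi
    have hneg : 0 ≤ -m := by omega
    have h1 : (((-m).toNat : ℕ) : ℤ) = -m := Int.toNat_of_nonneg hneg
    have h2 : (i : ℤ) < -m := by rw [← h1]; exact_mod_cast hi
    rw [abs_le]; constructor <;> omega

/-- the true pattern point equals the frozen-label one when the words agree on a window containing the layer index. -/
theorem pt_eq_ptL {π : Param} {s₀ : ℤ → ℤ} {M : ℕ} (h : ∀ i : ℤ, |i| ≤ M → π.2.2.1 i = s₀ i)
    {k : ℤ × ℤ × ℤ} (hk : |k.1| ≤ M) : pt π k = ptL s₀ k π := by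
  unfold pt ptL; rw [haggLabel_congr h hk]

/-! ## Definitions shared by the package (collected here so that parts 2–6 introduce no new definitions)

`Bset` — the Borel candidate for the strict matching event at fixed parameters (part 2); `ljBound` — the uniform bound
for Lennard-Jones sums over `δ`-separated sets (part 4); `rootEnergy'` — the clamped root energy
`((∫⁻ (V_LJ ‖y‖)⁺) − (∫⁻ (V_LJ ‖y‖)⁻))/2` as a real number (part 5). -/

/-- the Borel set of measures "matching the pattern with points `p`, scale `b`, tolerance `η`", written in
the measurable currency `μ (closed ball ∖ ⋃ open balls) = 0` / `μ (open ball) ≠ 0` -/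
def Bset (b η : ℝ) (p : ℤ × ℤ × ℤ → EuclideanSpace ℝ (Fin 3)) : Set (Measure (EuclideanSpace ℝ (Fin 3))) :=
  {μ | μ (closedBall 0 (4 * b) \ ⋃ k, ball (p k) η) = 0 ∧ ∀ k, ‖p k‖ ≤ 5 * b → μ (ball (p k) η) ≠ 0}

/-- The uniform site-energy bound `M(δ)`. -/
noncomputable def ljBound (δ : ℝ) : ℝ :=
  (2 * 1 / δ + 1) ^ 3 * ((1 / 12) * δ⁻¹ ^ 12 + (1 / 6) * δ⁻¹ ^ 6) + 1 / 4 * (250 * (min δ 1)⁻¹ ^ 6)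

/-- Measurable surrogate of the ROOT SITE ENERGY `ν ↦ (∫ y, V_LJ ‖y‖ ∂ν)/2` (difference of the `lintegral`s of the
positive and negative parts — agrees with the Bochner form wherever `y ↦ V_LJ ‖y‖` is `ν`-integrable). -/
noncomputable def rootEnergy' (ν : Measure (EuclideanSpace ℝ (Fin 3))) : ℝ :=
  ((∫⁻ y, ENNReal.ofReal (lennardJones ‖y‖) ∂ν).toReal
    - (∫⁻ y, ENNReal.ofReal (- lennardJones ‖y‖) ∂ν).toReal) / 2

end Summit.AtomisticToContinuum.Crystallization.Theorems.ChartedPlanarOrderDefectEventGeometry
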